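import Literature.AlgebraicGeometry.Resolution.CentreBlowupThm36Point
import Literature.AlgebraicGeometry.Resolution.CentreBlowupMohStability
import Literature.AlgebraicGeometry.Resolution.CentreBlowupProp31
import HarnessLib

/-!
# [CP19] Theorem 3.6 (1) for permissible centres OF THE FIRST KIND of any dimension, proved in the
# coordinate model: an increase of `ε` forces `ω(x) = ε(x)`, `δ(y) ∈ ℕ` and `H_{j'} ∈ pℕ`

Topic: `Literature/AlgebraicGeometry/Resolution`.  Cell `pub-rosobs` (resolution observatory), unit
`pub-rosobs-carver-g25`; sequel of `CentreBlowupThm36Point.lean` / `CentreBlowupThm36PointChart.lean`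
(the point centre `𝒴 = {x}`) and of `CentreBlowupProp31.lean` ([CP19, Prop. 3.1]: the anatomy of a
first-kind centre), by TRANSFER along the lift dictionary of `CentreBlowupMohStability.lean`
(`φ : y_i ↦ y_j y_i (i ∉ S)` carries the `C_S`-chart to the point chart).

* V. Cossart, O. Piltant, *Resolution of singularities of arithmetical threefolds*, J. Algebra **529**
  (2019) 268–535 = arXiv:1412.0868 [CossartPiltant2019], Theorem 3.6 (p. 35): "Let `π : 𝒳' → 𝒳` be
  the blowing up along a permissible center `𝒴` (of the first kind or second kind) at `x`,
  `x' ∈ π⁻¹(x)` … If `ε(x') > ε(x)`, the following holds: (1) we have `i₀(m_S) = p`,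
  `ε(y) = ε(x) = ω(x)`, `δ(y) ∈ ℕ`, `H_{j'} ∈ pℕ` for every `j' ∈ (J')_E` and
  `F_{p,Z} ∈ (k(x')[U₁,…,U_n])^p[{U_j}_{j ∈ J_E ∖ {j₂,…,j_{e'₀}}}]`"; Definition 3.1 (p. 31:
  first kind = Hironaka-permissible and `ε(y) = ε(x)`); Definition 2.16 (p. 24) and Proposition
  2.16 (i) (p. 21) for "`ε(x) = ω(x)` ⇔ `V(F_{p,Z},E,m_S) = 0`" (`G = 0`, so `TF_{p,Z} = F_{p,Z}`).
* T. T. Moh, Publ. RIMS **23** (1987) [Moh1987] and H. Hauser, S. Perlega, Publ. RIMS **55** (2019)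
  [HauserPerlega2019PRIMS]: the shade lemmas of `PointBlowupMohBound.lean` and their transfer to
  Moh-permissible coordinate centres (`CentreBlowupMohStability.shade_step_le_shade_pointStep`).

## Dictionary (model of `CentreBlowupAdaptedOrder.lean`: `h = Z^p + F(u)`, `G = 0`, `E = {u_i = 0}_{i ∈ exc}`)

`𝒴 ↔ C_S = V(Z, {u_i}_{i∈S})` (`J = S`), `y` its generic point, `ε(y) = epsilonAlong S s`,
`ε(x) = s.epsilon = ord₀F − Σ_{i∈exc} H_i`, first kind = `IsFirstKind p S s`; the chart `u = u_{j₁}`,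
`j₁ ∈ J`, is `j ∈ S`, the point `x' ∈ π⁻¹(x)` is `b` with `b_j = 0` and `b_i = 0` off `S`;
`(J')_E = exc ∖ S`; `{j₂,…,j_{e'₀}} = {i ∈ S ∩ exc : i ≠ j, b_i = 0}`; `p δ(y) = ord_{C_S} F`.

## What is proved (every field `K` of characteristic `p`, every finite index type `σ`)

Point level (namespace `PointBlowup`; `s = (F, r)`, boundary `E`, `ord₀ F = o ≥ p`, chart `j ∉ E`
with `∂F_o/∂y_j ≠ 0`, `b_j = 0`):
* `shade_step_aux_le_epsilon_of_pderiv_chart_ne_zero` — the chart-variable clause of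
  `CentreBlowupThm36PointChart.lean` in Moh's bookkeeping: the POINT blow-up of the auxiliary state
  `t = (F, H|_E)` has `shade(t') ≤ ε(E, x)` (which is `shade(t)`).  (The `ε`-form there follows from
  `ε(E', x') ≤ shade(t')`; the shade form is what transfers to centres.)

Centre level (namespace `CentreBlowup.CState`; `S ∋ j`, `b_j = 0`, `b_i = 0` off `S`, `s` a state
with `IsFirstKind p S s`, `ord₀ F = o`):
* `not_epsilonIncreases_of_isFirstKind_of_not_dvd` — "`δ(y) ∈ ℕ`", first half: an increase of `ε`
  needs `p ∣ ord₀ F`;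
* `not_epsilonIncreases_of_isFirstKind_of_not_dvd_apply` — the membership clause: an increase needs
  `p ∣ d_i` for every initial monomial `y^d` and every `i ≠ j` that is untranslated (`b_i = 0`, in
  particular every `i ∉ S`) or non-exceptional (`i ∉ exc`);
* `dvd_bigH_of_epsilonIncreases_of_isFirstKind` — "`H_{j'} ∈ pℕ` for every `j' ∈ (J')_E`"
  (with Prop. 3.1: `d_{j'} = H_{j'}` on the initial form); `dvd_ordAlong_of_epsilonIncreases_of_isFirstKind`
  — "`δ(y) ∈ ℕ`": `p ∣ ord_{C_S} F`;
* `not_epsilonIncreases_of_isFirstKind_of_vNonzero`, `omega_eq_epsilon_of_epsilonIncreases_of_isFirstKind`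
  — "`ε(x) = ω(x)`": `V(F,E) ≠ 0` forbids any increase of `ε` under the blow-up of a first-kind
  centre, at every point of the fibre over `x` in every chart;
* **`epsilonIncreaseForcesFirstKindAt_of_isFirstKind`** — the atlas predicate
  `EpsilonIncreaseForcesFirstKindAt p S j b s` HOLDS at every centre of the first kind, every chart,
  every point (for the point centre `S = univ` this is `CentreBlowupThm36PointChart`'s theorem).

## Proof

At a first-kind centre, "`ε(y) = ε(x)`" unpacks to `ord₀ F = ord_{C_S} F + Σ_{exc∖S} H_i`
(`CentreBlowupProp31.ordZero_eq_of_isFirstKind`), which says exactly that the auxiliary state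
`(F, H|_exc, exc)` is MOH-PERMISSIBLE for `C_S` in the sense of `CentreBlowupMohStability.lean`
(`degIn S r + shade ≤ degIn S d` for every monomial).  Hence (i) after the `C_S`-step the new
multiplicity record of the auxiliary state bounds the new minimum exponents on `E'` from below, so
`ε(x') ≤ shade` of the `C_S`-step of the auxiliary state; (ii) by `shade_step_le_shade_pointStep`
this is at most the shade of the POINT-step of `(F, H|_exc)` with the same chart and point; (iii) the
point-level shade lemmas (`PointBlowupMohBound.shade_step_le_of_not_dvd(_apply)` and the Euler
argument above) bound the latter by `shade(F, H|_exc) = ε(x)` under each witness hypothesis.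

## Scope (honest)

Coordinate centres `C_S` through the origin in the given variables, points of the fibre over the
origin, the model's cleaning (perfect-field reading), `G = 0`; `ω(x) > 0`, **(E)** and the
equimultiplicity of `x'` are not needed.  NOT treated: centres of the SECOND kind (there Thm. 3.6 (1)
says `ε` never increases; the auxiliary state is then NOT Moh-permissible — `ord₀F = ord_{C_S}F +
Σ_{exc∖S}H_i + 1` — and the transfer above does not apply), the clause `i₀(m_S) = p` (`i₀` is not
modelled) and assertion (2).  So `EpsilonIncreaseForcesFirstKindAt` is established here under the
extra hypothesis `IsFirstKind p S s`, not for every permissible centre.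
-/

open MvPolynomial Finset

open scoped BigOperators

namespace Literature.AlgebraicGeometry.Resolution

open Literature.AlgebraicGeometry.Resolution.Hauser2010
open Literature.AlgebraicGeometry.Resolution.HauserPerlega2019 (initialForm)

namespace PointBlowup

/-! ### 0. Private helpers (as in `CentreBlowupThm36Point.lean`) -/

section Helpers

variable {σ : Type*} {K : Type*} [Field K]

/-- evaluation of `bigHVec`. [folklore] -/
private theorem bigHVec_apply' [DecidableEq σ] (E : Finset σ) (F : MvPolynomial σ K) (i : σ) :
    bigHVec E F i = if i ∈ E then (bigH F i).toNat else 0 := by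
  unfold bigHVec
  rw [Finsupp.finsetSum_apply]
  by_cases hi : i ∈ E
  · rw [if_pos hi, Finset.sum_eq_single_of_mem i hi (fun j _ hji => by
      rw [Finsupp.single_apply, if_neg hji])]
    exact Finsupp.single_eq_same
  · rw [if_neg hi]
    exact Finset.sum_eq_zero fun j hj => by
      have hji : j ≠ i := fun h => hi (h ▸ hj)
      rw [Finsupp.single_apply, if_neg hji]

/-- `H_i ≤ d_i` for every monomial `y^d` of `F`. [folklore] -/
private theorem bigH_le' {F : MvPolynomial σ K} {d : σ →₀ ℕ} (hd : d ∈ F.support) (i : σ) :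
    bigH F i ≤ d i :=
  Finset.inf_le (f := fun d : σ →₀ ℕ => ((d i : ℕ) : ℕ∞)) hd

/-- For `F ≠ 0`, `H_i` is finite. [folklore] -/
private theorem bigH_eq_toNat' {F : MvPolynomial σ K} (hF : F ≠ 0) (i : σ) :
    bigH F i = (((bigH F i).toNat : ℕ) : ℕ∞) := by
  obtain ⟨d, -, h⟩ := Finset.exists_mem_eq_inf F.support (MvPolynomial.support_nonempty.mpr hF)
    (fun d : σ →₀ ℕ => ((d i : ℕ) : ℕ∞))
  rw [show bigH F i = ((d i : ℕ) : ℕ∞) from h]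
  rfl

/-- For `F ≠ 0`, `ord₀ F` is finite. [folklore] -/
private theorem exists_ordZero_eq' {F : MvPolynomial σ K} (hF : F ≠ 0) : ∃ o : ℕ, ordZero F = o := by
  have hne : ordZero F ≠ ⊤ := by
    unfold ordZero
    rw [Ne, MvPowerSeries.order_eq_top_iff, MvPolynomial.coe_eq_zero_iff]
    exact hF
  exact ⟨(ordZero F).toNat, (ENat.coe_toNat hne).symm⟩

/-- A finite order means a non-zero polynomial. [folklore] -/
private theorem ne_zero_of_ordZero_eq' {F : MvPolynomial σ K} {o : ℕ} (ho : ordZero F = o) : F ≠ 0 := by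
  intro h
  rw [h, ordZero_zero] at ho
  exact ENat.top_ne_coe _ ho

/-- `y^{H|_E} ∣ F` monomialwise. [folklore] -/
private theorem bigHVec_le' [DecidableEq σ] (E : Finset σ) (F : MvPolynomial σ K) :
    ∀ d ∈ F.support, bigHVec E F ≤ d := by
  intro d hd
  have hF : F ≠ 0 := MvPolynomial.ne_zero_iff.mpr ⟨d, MvPolynomial.mem_support_iff.mp hd⟩
  rw [Finsupp.le_def]
  intro i
  rw [bigHVec_apply']
  split_ifs with hi
  · have h := bigH_le' hd i
    rw [bigH_eq_toNat' hF] at h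
    exact_mod_cast h
  · exact Nat.zero_le _

/-- `Σ_{i ∈ E} H_i = |H|_E|` for `F ≠ 0`. [folklore] -/
private theorem sum_bigH_eq' [DecidableEq σ] {F : MvPolynomial σ K} (hF : F ≠ 0) (E : Finset σ) :
    ∑ j ∈ E, bigH F j = (((bigHVec E F).degree : ℕ) : ℕ∞) := by
  unfold bigHVec
  rw [map_sum, Nat.cast_sum]
  exact Finset.sum_congr rfl fun j _ => by
    rw [Finsupp.degree_single]
    exact bigH_eq_toNat' hF j

/-- `ε(E, x)` is the shade of the auxiliary state `(F, H|_E)`. [folklore] -/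
private theorem epsilon_eq_shade' [DecidableEq σ] (E : Finset σ) (s : State σ K) (hF : s.F ≠ 0) :
    epsilon E s = (⟨s.F, bigHVec E s.F⟩ : State σ K).shade := by
  show ordZero s.F - ∑ j ∈ E, bigH s.F j = ordZero s.F - (((bigHVec E s.F).degree : ℕ) : ℕ∞)
  rw [sum_bigH_eq' hF]

end Helpers

/-! ### 1. Private helpers for the Euler-operator argument -/

section Euler

variable {σ : Type*} {K : Type*} [Field K]

/-- `y_i ∂_i (c y^e) = e_i c y^e`. [folklore] -/
private theorem X_mul_pderiv_monomial' (i : σ) (e : σ →₀ ℕ) (c : K) :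
    X i * pderiv i (monomial e c) = monomial e (((e i : ℕ) : K) * c) := by
  rw [X_mul_pderiv_monomial, ← Nat.cast_smul_eq_nsmul K, smul_monomial, smul_eq_mul]

/-- In characteristic `p`, partial derivatives do not see `p`-th power monomials. [folklore] -/
private theorem pderiv_deletePthPowers' [DecidableEq σ] (p : ℕ) [CharP K p] (i : σ)
    (Q : MvPolynomial σ K) : pderiv i (deletePthPowers p Q) = pderiv i Q := by
  ext m
  rw [coeff_pderiv, coeff_pderiv, coeff_deletePthPowers]
  split_ifs with h
  · have hdvd : p ∣ m i + 1 := by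
      have := (isPthPowerExponent_iff p _).mp h i
      rwa [Finsupp.add_apply, Finsupp.single_eq_same] at this
    have hzero : ((m i : K) + 1) = 0 := by
      rw [← Nat.cast_succ, CharP.cast_eq_zero_iff K p]
      exact hdvd
    rw [hzero, mul_zero, mul_zero]
  · rfl

/-- Every monomial of `∑_{i∈L} (y_i + b_i) ∂_i R` lies at most one degree below a monomial of `R`.
[folklore] -/
private theorem exists_support_of_mem_support_euler' [Fintype σ] [DecidableEq σ] (L : Finset σ)
    (b : σ → K)
    (R : MvPolynomial σ K) {e' : σ →₀ ℕ}
    (he' : e' ∈ (∑ i ∈ L, (X i + C (b i)) * pderiv i R).support) :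
    ∃ e ∈ R.support, e.degree ≤ e'.degree + 1 := by
  rw [MvPolynomial.mem_support_iff, coeff_sum] at he'
  obtain ⟨i, -, hi⟩ := Finset.exists_ne_zero_of_sum_ne_zero he'
  rw [add_mul, coeff_add, coeff_X_mul', coeff_C_mul] at hi
  by_cases hc : coeff e' (pderiv i R) = 0
  · rw [hc, mul_zero, add_zero] at hi
    split_ifs at hi with hmem
    · rw [coeff_pderiv] at hi
      refine ⟨e' - Finsupp.single i 1 + Finsupp.single i 1,
        MvPolynomial.mem_support_iff.mpr (left_ne_zero_of_mul hi), ?_⟩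
      rw [map_add, Finsupp.degree_single]
      exact Nat.add_le_add_right (degree_le_degree_of_le tsub_le_self) 1
    · exact absurd rfl hi
  · rw [coeff_pderiv] at hc
    exact ⟨e' + Finsupp.single i 1, MvPolynomial.mem_support_iff.mpr (left_ne_zero_of_mul hc),
      by rw [map_add, Finsupp.degree_single]⟩

/-- Euler's identity modulo `p`: if `p ∣ |d|` and `p ∣ d_i` off `L ∪ {j}` then
`∑_{i∈L} d_i = −d_j` in `K`. [folklore] -/
private theorem euler_sum' [Fintype σ] [DecidableEq σ] (p : ℕ) [CharP K p] (j : σ) (L : Finset σ)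
    (hjL : j ∉ L) {d : σ →₀ ℕ} (hdeg : p ∣ d.degree) (hdiv : ∀ i, i ≠ j → i ∉ L → p ∣ d i) :
    ∑ i ∈ L, ((d i : ℕ) : K) = -((d j : ℕ) : K) := by
  have h0 : ((d.degree : ℕ) : K) = 0 := (CharP.cast_eq_zero_iff K p _).mpr hdeg
  rw [degree_eq_add_sum_erase j d, Nat.cast_add, Nat.cast_sum,
    ← Finset.sum_filter_add_sum_filter_not (univ.erase j) (fun i => i ∈ L)] at h0
  have h1 : (univ.erase j).filter (fun i => i ∈ L) = L := by
    ext i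
    simp only [Finset.mem_filter, Finset.mem_erase, Finset.mem_univ, and_true]
    exact ⟨fun h => h.2, fun h => ⟨fun hij => hjL (hij ▸ h), h⟩⟩
  have h2 : ∑ i ∈ (univ.erase j).filter (fun i => ¬ i ∈ L), ((d i : ℕ) : K) = 0 :=
    Finset.sum_eq_zero fun i hi => by
      rw [Finset.mem_filter, Finset.mem_erase] at hi
      exact (CharP.cast_eq_zero_iff K p _).mpr (hdiv i hi.1.1 hi.2)
  rw [h1, h2, add_zero] at h0
  exact eq_neg_of_add_eq_zero_right h0

/-- A monomial of the cleaned first layer (`y_j`-exponent `o − q`) of the translated chart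
transform is a monomial of the new residual polynomial: the other layers sit at `y_j`-exponents
`≥ o + 1 − q`. [folklore] -/
private theorem mem_support_step_of_layer' [Fintype σ] [DecidableEq σ] [DecidableEq K] (q : ℕ)
    (j : σ) (b : σ → K) (hbj : b j = 0) (s : State σ K) {o : ℕ} (ho : ordZero s.F = o)
    (hqo : q ≤ o) {e : σ →₀ ℕ} (hej : e j = o - q)
    (he : e ∈ (deletePthPowers q (translate b (∑ d ∈ s.F.support with d.degree = o,
        monomial (chartExponent q j d) (coeff d s.F)))).support) :
    e ∈ (step q j b s).F.support := by
  rw [MvPolynomial.mem_support_iff] at he ⊢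
  have hF : (step q j b s).F =
      deletePthPowers q (translate b (∑ d ∈ s.F.support with d.degree = o,
        monomial (chartExponent q j d) (coeff d s.F))) +
      deletePthPowers q (translate b (∑ d ∈ s.F.support with ¬ d.degree = o,
        monomial (chartExponent q j d) (coeff d s.F))) := by
    show deletePthPowers q (pointTransform q j b s) = _
    unfold pointTransform chartTransform translate
    rw [← deletePthPowers_add, ← map_add, Finset.sum_filter_add_sum_filter_not]
  rw [hF, coeff_add]
  have hzero : coeff e (deletePthPowers q (translate b (∑ d ∈ s.F.support with ¬ d.degree = o,
      monomial (chartExponent q j d) (coeff d s.F)))) = 0 := by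
    rw [coeff_deletePthPowers]
    split_ifs with hP
    · rfl
    unfold translate
    rw [map_sum, coeff_sum]
    refine Finset.sum_eq_zero fun d hd => ?_
    rw [Finset.mem_filter] at hd
    by_contra hne
    have h1 := apply_eq_of_coeff_translate_monomial_ne_zero b hbj hne
    rw [chartExponent_apply, if_pos rfl] at h1
    have h2 := le_degree_of_ordZero_eq s ho d hd.1
    omega
  rw [hzero, add_zero]
  exact he

end Euler

/-! ### 2. The chart-variable clause in Moh's bookkeeping (point level) -/

section Main

variable {σ : Type*} {K : Type*} [Field K] [Fintype σ] [DecidableEq σ] [DecidableEq K]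
variable (p : ℕ) [hp : Fact p.Prime] [CharP K p]

/-- **The chart-variable clause of [CP19, Thm. 3.6 (1)], shade form.**  For a residual polynomial
`F` of order `o ≥ p`, a boundary `E`, a non-exceptional chart `j ∉ E` with `∂F_o/∂y_j ≠ 0` and a point
`b` of the exceptional divisor, the point blow-up of the auxiliary state `(F, H|_E)` has shade
`≤ ε(E, x)`: the new residual polynomial has a monomial of degree `≤ |r'| + ε(E,x)` in the layer
`y_j^{o−p}` ("`F_{p,Z} ∈ (k(x')[U])^p[{U_j}_{j ∈ J_E ∖ {j₂,…}}]`" with `u = u_{j₁}`, `j₁ ∉ J_E`,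
contrapositive).  [cite: CossartPiltant2019, Thm. 3.6 (1) (p. 35)] -/
theorem shade_step_aux_le_epsilon_of_pderiv_chart_ne_zero (j : σ) (b : σ → K) (hbj : b j = 0)
    (s : State σ K) (E : Finset σ) (hjE : j ∉ E) {o : ℕ} (ho : ordZero s.F = o) (hpo : p ≤ o)
    (hpd : pderiv j (initialForm s.F) ≠ 0) :
    (step p j b ⟨s.F, bigHVec E s.F⟩).shade ≤ epsilon E s := by
  have hF : s.F ≠ 0 := ne_zero_of_ordZero_eq' ho
  -- the auxiliary state `t = (F, H|_E)`: Moh-admissible, of shade `ε(E, x)`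
  set t : State σ K := ⟨s.F, bigHVec E s.F⟩ with ht
  have hrt : ∀ d ∈ t.F.support, t.r ≤ d := bigHVec_le' E s.F
  have hεt : epsilon E s = t.shade := epsilon_eq_shade' E s hF
  rw [hεt]
  by_contra hlt
  rw [not_le] at hlt
  -- (R1) `p ∣ o` and (R2) exponents `≡ 0 (mod p)` off `L ∪ {j}`, by Moh / Hauser–Perlega on `t`
  have hR1 : p ∣ o := by
    by_contra hnd
    exact absurd (shade_step_le_of_not_dvd p j b hbj t ho hpo hrt hnd) (not_le.mpr hlt)
  set L : Finset σ := E.filter (fun i => b i ≠ 0) with hL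
  have hjL : j ∉ L := fun h => hjE (Finset.mem_filter.mp h).1
  have hR2 : ∀ d ∈ s.F.support, d.degree = o → ∀ i, i ≠ j → i ∉ L → p ∣ d i := by
    intro d hd hdeg i hij hiL
    by_contra hnd
    have hfix : b i = 0 ∨ t.r i = 0 := by
      by_cases hiE : i ∈ E
      · left
        by_contra hb
        exact hiL (Finset.mem_filter.mpr ⟨hiE, hb⟩)
      · right
        show bigHVec E s.F i = 0
        rw [bigHVec_apply', if_neg hiE]
    exact absurd (shade_step_le_of_not_dvd_apply p j b hbj t ho hpo hrt hij hfix hd hdeg hnd)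
      (not_le.mpr hlt)
  obtain ⟨d₀, hd₀, hd₀deg, hd₀j⟩ := exists_not_dvd_of_pderiv_initialForm_ne_zero p ho hpd
  -- the chart transform of the initial form, its `j`-weighted version, the cleaned first layer
  set T : Finset (σ →₀ ℕ) := s.F.support.filter (fun d => d.degree = o) with hT
  set P₀ : MvPolynomial σ K := ∑ d ∈ T, monomial (chartExponent p j d) (coeff d s.F) with hP₀
  set g : MvPolynomial σ K :=
    ∑ d ∈ T, monomial (chartExponent p j d) (((d j : ℕ) : K) * coeff d s.F) with hg
  set R : MvPolynomial σ K := deletePthPowers p (translate b P₀) with hR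
  -- Euler's identity modulo `p`: `∑_{i∈L} y_i ∂_i P₀ = -g`
  have hA : ∑ i ∈ L, X i * pderiv i P₀ = -g := by
    have h1 : ∀ i ∈ L, X i * pderiv i P₀ =
        ∑ d ∈ T, monomial (chartExponent p j d) (((d i : ℕ) : K) * coeff d s.F) := by
      intro i hi
      have hij : i ≠ j := fun h => hjL (h ▸ hi)
      rw [hP₀, map_sum (pderiv i), Finset.mul_sum]
      refine Finset.sum_congr rfl fun d _ => ?_
      rw [X_mul_pderiv_monomial', chartExponent_apply, if_neg hij]
    rw [Finset.sum_congr rfl h1, Finset.sum_comm, hg, ← Finset.sum_neg_distrib]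
    refine Finset.sum_congr rfl fun d hd => ?_
    have hdF : d ∈ s.F.support := (Finset.mem_filter.mp hd).1
    have hddeg : d.degree = o := (Finset.mem_filter.mp hd).2
    rw [← map_sum (monomial (chartExponent p j d)), ← Finset.sum_mul,
      euler_sum' p j L hjL (by rw [hddeg]; exact hR1) (hR2 d hdF hddeg), neg_mul, map_neg]
  -- translate and clean: `g(y + b) = -∑_{i∈L} (y_i + b_i) ∂_i R`
  have hB : translate b g = -∑ i ∈ L, (X i + C (b i)) * pderiv i R := by
    have hg' : g = -∑ i ∈ L, X i * pderiv i P₀ := by rw [hA, neg_neg]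
    rw [hg']
    unfold translate
    rw [map_neg, map_sum]
    congr 1
    refine Finset.sum_congr rfl fun i _ => ?_
    simp only [map_mul, aeval_X]
    congr 1
    show translate b (pderiv i P₀) = pderiv i (deletePthPowers p (translate b P₀))
    rw [pderiv_deletePthPowers', pderiv_translate]
  -- the auxiliary multiplicity record after the step
  set ρ : σ →₀ ℕ := (bigHVec E s.F).update j (o - p) with hρ
  have hρj : ρ j = o - p := by rw [hρ, Finsupp.update_apply, if_pos rfl]
  have hρi : ∀ i, i ≠ j → ρ i = bigHVec E s.F i := fun i hi => by
    rw [hρ, Finsupp.update_apply, if_neg hi]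
  have hHj : bigHVec E s.F j = 0 := by rw [bigHVec_apply', if_neg hjE]
  have hdegH : (bigHVec E s.F).degree + 1 ≤ o := by
    have hle : bigHVec E s.F + Finsupp.single j 1 ≤ d₀ := by
      rw [Finsupp.le_def]
      intro i
      rw [Finsupp.add_apply, Finsupp.single_apply]
      by_cases hij : j = i
      · subst hij
        rw [hHj, zero_add, if_pos rfl]
        exact Nat.one_le_iff_ne_zero.mpr (fun h => hd₀j (h ▸ dvd_zero p))
      · rw [if_neg hij, add_zero]
        exact Finsupp.le_def.mp (bigHVec_le' E s.F d₀ hd₀) i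
    have := degree_le_degree_of_le hle
    rw [map_add, Finsupp.degree_single, hd₀deg] at this
    exact this
  have hρdeg : ρ.degree = (bigHVec E s.F).degree + (o - p) := by
    have := degree_update_add (bigHVec E s.F) j (o - p)
    rw [hHj, add_zero] at this
    rw [hρ]
    exact this
  -- the layer lemma applied to `g`
  have hsuppg : ∀ e ∈ g.support,
      ∃ d ∈ T, ((d j : ℕ) : K) * coeff d s.F ≠ 0 ∧ chartExponent p j d = e :=
    fun e he => exists_of_mem_support_sum_monomial T _ _ he
  have hρle : ∀ e ∈ g.support, ρ ≤ e := by
    intro e he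
    obtain ⟨d, hd, -, rfl⟩ := hsuppg e he
    have hdF : d ∈ s.F.support := (Finset.mem_filter.mp hd).1
    have hddeg : d.degree = o := (Finset.mem_filter.mp hd).2
    rw [Finsupp.le_def]
    intro i
    rw [chartExponent_apply]
    by_cases hij : i = j
    · rw [if_pos hij, hij, hρj, hddeg]
    · rw [if_neg hij, hρi i hij]
      exact Finsupp.le_def.mp (bigHVec_le' E s.F d hdF) i
  have hD : ∀ e ∈ g.support, e j = ρ j →
      e.degree ≤ ρ.degree + (o - 1 - (bigHVec E s.F).degree) := by
    intro e he _
    obtain ⟨d, hd, hne, rfl⟩ := hsuppg e he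
    have hddeg : d.degree = o := (Finset.mem_filter.mp hd).2
    have hdj : 1 ≤ d j := by
      rw [Nat.one_le_iff_ne_zero]
      intro h0
      apply hne
      rw [h0, Nat.cast_zero, zero_mul]
    rw [degree_chartExponent, hρdeg, hddeg]
    omega
  have hlay : ∃ e ∈ g.support, e j = ρ j := by
    refine ⟨chartExponent p j d₀, ?_, by rw [chartExponent_apply, if_pos rfl, hρj, hd₀deg]⟩
    rw [MvPolynomial.mem_support_iff, hg, coeff_sum_monomial_of_injOn T
      (fun d => chartExponent p j d) (fun d => ((d j : ℕ) : K) * coeff d s.F)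
      (Finset.mem_filter.mpr ⟨hd₀, hd₀deg⟩) ?_]
    · exact mul_ne_zero (fun h => hd₀j ((CharP.cast_eq_zero_iff K p _).mp h))
        (MvPolynomial.mem_support_iff.mp hd₀)
    · intro d hd _ heq
      have hddeg : d.degree = o := (Finset.mem_filter.mp hd).2
      exact chartExponent_injective (by rw [hddeg]; exact hpo) (by rw [hd₀deg]; exact hpo) heq
  obtain ⟨E', hE', -, hE'deg⟩ :=
    exists_mem_support_translate_layer b hbj g ρ hρle (o - 1 - (bigHVec E s.F).degree) hD hlay
  -- `E'` is a monomial of the Euler operator applied to `R`; pull it back to `R`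
  have hE'2 : E' ∈ (∑ i ∈ L, (X i + C (b i)) * pderiv i R).support := by
    rw [MvPolynomial.mem_support_iff] at hE' ⊢
    rw [hB, coeff_neg] at hE'
    exact neg_ne_zero.mp hE'
  obtain ⟨e, he, hedeg⟩ := exists_support_of_mem_support_euler' L b R hE'2
  have hej : e j = o - p := by
    have he' : coeff e (translate b P₀) ≠ 0 := by
      have := MvPolynomial.mem_support_iff.mp he
      rw [hR, coeff_deletePthPowers] at this
      split_ifs at this with hh
      · exact absurd rfl this
      · exact this
    unfold translate at he'
    rw [hP₀, map_sum, coeff_sum] at he'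
    obtain ⟨d, hd, hne⟩ := Finset.exists_ne_zero_of_sum_ne_zero he'
    have h1 := apply_eq_of_coeff_translate_monomial_ne_zero b hbj hne
    rw [chartExponent_apply, if_pos rfl, (Finset.mem_filter.mp hd).2] at h1
    exact h1
  have hestep : e ∈ (step p j b s).F.support :=
    mem_support_step_of_layer' p j b hbj s ho hpo hej (by rw [hR, hP₀, hT] at he; exact he)
  -- the bound on `ε(E', x')` through the auxiliary state `t = (F, H|_E)`
  have hr' : (step p j b t).r = ρ.filter (fun i => b i = 0) := by
    rw [hρ]
    exact newMult_eq p j b hbj t ho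
  have hshade : (step p j b t).shade ≤ ((o - (bigHVec E s.F).degree : ℕ) : ℕ∞) := by
    refine shade_le_of_mem_support (step p j b t) (E := e) hestep ?_
    rw [hr']
    omega
  have hts : t.shade = ((o - (bigHVec E s.F).degree : ℕ) : ℕ∞) := shade_eq_of_ordZero_eq t ho
  have hfin := lt_of_lt_of_le hlt hshade
  rw [hts] at hfin
  exact lt_irrefl _ hfin

end Main

end PointBlowup

/-! ### 3. Centres of the first kind, any dimension -/

namespace CentreBlowup

namespace CState

section FirstKind

variable {σ : Type*} {K : Type*} [Field K] [Fintype σ] [DecidableEq σ] [DecidableEq K]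
variable (p : ℕ) [hp : Fact p.Prime] [CharP K p]

omit [Fintype σ] hp [CharP K p] in
/-- The blow-up of the zero polynomial has `ε = 0` (`E' ∋ j` is non-empty and `H_j(0) = ⊤`). [folklore] -/
private theorem epsilon_step_of_F_eq_zero' (q : ℕ) (S : Finset σ) (j : σ) (b : σ → K)
    (s : CState σ K) (hF : s.F = 0) : (step q S j b s).epsilon = 0 := by
  have h1 : (step q S j b s).F = 0 := by
    show deletePthPowers q (PointBlowup.translate b (chartTransform q S j s.F)) = 0
    unfold chartTransform PointBlowup.translate
    rw [hF, MvPolynomial.support_zero, Finset.sum_empty, map_zero, deletePthPowers_zero]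
  have hj : j ∈ (step q S j b s).exc := by
    show j ∈ newExc j b s
    exact Finset.mem_insert_self _ _
  have htop : PointBlowup.bigH (0 : MvPolynomial σ K) j = ⊤ := by
    unfold PointBlowup.bigH
    rw [MvPolynomial.support_zero, Finset.inf_empty]
  have h2 : ∑ i ∈ (step q S j b s).exc, PointBlowup.bigH (0 : MvPolynomial σ K) i = ⊤ := by
    refine eq_top_iff.mpr ?_
    calc (⊤ : ℕ∞) = PointBlowup.bigH (0 : MvPolynomial σ K) j := htop.symm
      _ ≤ ∑ i ∈ (step q S j b s).exc, PointBlowup.bigH (0 : MvPolynomial σ K) i :=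
          Finset.single_le_sum (f := fun i => PointBlowup.bigH (0 : MvPolynomial σ K) i)
            (fun _ _ => zero_le) hj
  rw [epsilon_eq, h1, h2]
  exact ENat.sub_top _

omit [Fintype σ] hp [CharP K p] in
/-- An increase of `ε` can only happen for `F ≠ 0`. [folklore] -/
private theorem F_ne_zero_of_epsilonIncreases' {q : ℕ} {S : Finset σ} {j : σ} {b : σ → K}
    {s : CState σ K} (hinc : EpsilonIncreases q S j b s) : s.F ≠ 0 := by
  intro hF
  unfold EpsilonIncreases at hinc
  rw [epsilon_step_of_F_eq_zero' q S j b s hF] at hinc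
  exact not_lt_of_ge zero_le hinc

omit [DecidableEq K] hp [CharP K p] in
/-- **"`ε(y) = ε(x)`" = Moh-permissibility of the auxiliary state `(F, H|_exc, exc)`.**  At a
first-kind centre with `ord₀ F = o`: `q ≤ o`, every monomial has `degIn S d ≥ q`, and
`degIn S (H|_exc) + (o − |H|_exc|) ≤ degIn S d` (the left side being `ord_{C_S} F`).
[cite: CossartPiltant2019, Def. 3.1 (p. 31) and Prop. 3.1 (p. 31), proof] -/
private theorem mohPerm_aux_of_isFirstKind' {q : ℕ} {S : Finset σ} {s : CState σ K}
    (h1 : IsFirstKind q S s) {o : ℕ} (ho : ordZero s.F = o) :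
    q ≤ o ∧ (∀ d ∈ s.F.support, q ≤ degIn S d) ∧
      (∀ d ∈ s.F.support, degIn S (PointBlowup.bigHVec s.exc s.F) +
        (o - (PointBlowup.bigHVec s.exc s.F).degree) ≤ degIn S d) ∧
      ordAlong S s.F = ((degIn S (PointBlowup.bigHVec s.exc s.F) +
        (o - (PointBlowup.bigHVec s.exc s.F).degree) : ℕ) : ℕ∞) := by
  obtain ⟨⟨-, hqord⟩, hii⟩ := h1
  have hF : s.F ≠ 0 := PointBlowup.ne_zero_of_ordZero_eq' ho
  set H : σ → ℕ := fun i => (PointBlowup.bigH s.F i).toNat with hHdef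
  have hH : ∀ i, PointBlowup.bigH s.F i = ((H i : ℕ) : ℕ∞) :=
    fun i => PointBlowup.bigH_eq_toNat' hF i
  have hne : s.F.support.Nonempty := MvPolynomial.support_nonempty.mpr hF
  obtain ⟨d₀, hd₀, hdeg⟩ :=
    Finset.exists_mem_eq_inf s.F.support hne (fun d : σ →₀ ℕ => (degIn S d : ℕ∞))
  have hoS : ordAlong S s.F = (degIn S d₀ : ℕ∞) := hdeg
  have hHle : ∀ d ∈ s.F.support, ∀ i, H i ≤ d i := fun d hd i => by
    have h := PointBlowup.bigH_le' hd i
    rw [hH i] at h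
    exact_mod_cast h
  have hmin : ∀ d ∈ s.F.support, degIn S d₀ ≤ degIn S d := fun d hd => by
    have h : ordAlong S s.F ≤ (degIn S d : ℕ∞) := Finset.inf_le hd
    rw [hoS] at h
    exact_mod_cast h
  obtain ⟨⟨d₁, hd₁, hdeg₁⟩, -⟩ := (ordZero_eq_nat_iff s.F o).mp ho
  have hA : ∑ i ∈ S ∩ s.exc, H i ≤ degIn S d₀ :=
    le_trans (Finset.sum_le_sum fun i _ => hHle d₀ hd₀ i)
      (Finset.sum_le_sum_of_subset Finset.inter_subset_left)
  have hB : ∑ i ∈ s.exc, H i ≤ o := by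
    rw [← hdeg₁, Finsupp.degree_eq_sum]
    exact le_trans (Finset.sum_le_sum fun i _ => hHle d₁ (MvPolynomial.mem_support_iff.mpr hd₁) i)
      (Finset.sum_le_sum_of_subset (Finset.subset_univ _))
  have hsumE : ∀ E : Finset σ, ∑ j ∈ E, PointBlowup.bigH s.F j = ((∑ j ∈ E, H j : ℕ) : ℕ∞) :=
    fun E => by
      rw [Nat.cast_sum]
      exact Finset.sum_congr rfl fun i _ => hH i
  have hnat : degIn S d₀ - ∑ i ∈ S ∩ s.exc, H i = o - ∑ i ∈ s.exc, H i := by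
    have h := hii
    unfold epsilonAlong at h
    rw [epsilon_eq, hoS, ho, hsumE, hsumE, ← ENat.coe_sub, ← ENat.coe_sub] at h
    exact_mod_cast h
  have hdegIn : degIn S (PointBlowup.bigHVec s.exc s.F) = ∑ i ∈ S ∩ s.exc, H i := by
    unfold degIn
    rw [← Finset.sum_ite_mem]
    exact Finset.sum_congr rfl fun i _ => PointBlowup.bigHVec_apply' s.exc s.F i
  have hdegree : (PointBlowup.bigHVec s.exc s.F).degree = ∑ i ∈ s.exc, H i := by
    unfold PointBlowup.bigHVec
    rw [map_sum]
    exact Finset.sum_congr rfl fun i _ => by rw [Finsupp.degree_single]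
  have hq0 : q ≤ degIn S d₀ := by
    rw [hoS] at hqord
    exact_mod_cast hqord
  have hkey : degIn S (PointBlowup.bigHVec s.exc s.F) +
      (o - (PointBlowup.bigHVec s.exc s.F).degree) = degIn S d₀ := by
    rw [hdegIn, hdegree]
    omega
  refine ⟨?_, fun d hd => le_trans hq0 (hmin d hd), fun d hd => hkey ▸ hmin d hd, by rw [hkey, hoS]⟩
  have := degIn_le_degree S d₁
  have h2 := hmin d₁ (MvPolynomial.mem_support_iff.mpr hd₁)
  omega

omit hp [CharP K p] in
/-- After the `C_S`-step, the new multiplicity record of the auxiliary state `(F, H|_exc, exc)` is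
dominated by the new minimum exponents on `E'`, so its shade dominates `ε(x')`. [folklore] -/
private theorem epsilon_step_le_shade_step_aux' (q : ℕ) (S : Finset σ) (j : σ) (b : σ → K)
    (hbj : b j = 0) (s : CState σ K) {o : ℕ} (ho : ordZero s.F = o)
    (hperm : ∀ d ∈ s.F.support, degIn S (PointBlowup.bigHVec s.exc s.F) +
      (o - (PointBlowup.bigHVec s.exc s.F).degree) ≤ degIn S d) :
    (step q S j b s).epsilon ≤
      (step q S j b ⟨s.F, PointBlowup.bigHVec s.exc s.F, s.exc⟩).shade := by
  set t : CState σ K := ⟨s.F, PointBlowup.bigHVec s.exc s.F, s.exc⟩ with ht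
  have hF' : (step q S j b t).F = (step q S j b s).F := rfl
  have hr : ∀ d ∈ t.F.support, t.r ≤ d := PointBlowup.bigHVec_le' s.exc s.F
  have hρ : ∀ e ∈ (step q S j b t).F.support, (step q S j b t).r ≤ e :=
    newMult_le_of_mem_support_step q S j b hbj t ho hr hperm
  have hρeq : (step q S j b t).r =
      (t.r.update j (degIn S t.r + (o - t.r.degree) - q)).filter (fun i => b i = 0) :=
    step_r_eq q S j b hbj t ho hr hperm
  have hsub : ∀ i, (step q S j b t).r i ≠ 0 → i ∈ (step q S j b s).exc := by
    intro i hi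
    rw [hρeq, Finsupp.filter_apply] at hi
    show i ∈ insert j (s.exc.filter fun i => b i = 0)
    rw [mem_insert, mem_filter]
    by_cases hij : i = j
    · exact Or.inl hij
    · right
      split_ifs at hi with hb
      · rw [Finsupp.update_apply, if_neg hij] at hi
        have hiE : i ∈ s.exc := by
          by_contra hiE
          apply hi
          show PointBlowup.bigHVec s.exc s.F i = 0
          rw [PointBlowup.bigHVec_apply', if_neg hiE]
        exact ⟨hiE, hb⟩
      · exact absurd rfl hi
  have h1 : (((step q S j b t).r.degree : ℕ) : ℕ∞) ≤
      ∑ i ∈ (step q S j b s).exc, PointBlowup.bigH (step q S j b s).F i :=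
    calc (((step q S j b t).r.degree : ℕ) : ℕ∞)
        = ∑ i ∈ (step q S j b t).r.support, (((step q S j b t).r i : ℕ) : ℕ∞) := by
          rw [Finsupp.degree_apply, Nat.cast_sum]
      _ ≤ ∑ i ∈ (step q S j b s).exc, (((step q S j b t).r i : ℕ) : ℕ∞) :=
          Finset.sum_le_sum_of_subset_of_nonneg
            (fun i hi => hsub i (Finsupp.mem_support_iff.mp hi)) (fun _ _ _ => zero_le)
      _ ≤ ∑ i ∈ (step q S j b s).exc, PointBlowup.bigH (step q S j b s).F i :=
          Finset.sum_le_sum fun i _ =>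
            Finset.le_inf fun e he => by
              exact_mod_cast Finsupp.le_def.mp (hρ e (hF' ▸ he)) i
  rw [epsilon_eq]
  show ordZero (step q S j b s).F - ∑ i ∈ (step q S j b s).exc, PointBlowup.bigH (step q S j b s).F i ≤
    ordZero (step q S j b t).F - (((step q S j b t).r.degree : ℕ) : ℕ∞)
  rw [hF']
  exact tsub_le_tsub_left h1 _

omit hp [CharP K p] in
/-- **Transfer.**  At a first-kind centre, `ε(x')` after the `C_S`-step (chart `j ∈ S`, point of the
fibre over the origin) is at most the shade of the POINT-step of the auxiliary state `(F, H|_exc)` with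
the same chart and point; and `ε(x)` is the shade of that auxiliary state.
[cite: CossartPiltant2019, Thm. 3.6 (1) (p. 35), proof strategy via Prop. 3.1] -/
private theorem epsilon_step_le_pointShade' (q : ℕ) {S : Finset σ} {j : σ} (hj : j ∈ S) (b : σ → K)
    (hbj : b j = 0) (hbN : ∀ i, i ∉ S → b i = 0) (s : CState σ K) (h1 : IsFirstKind q S s)
    {o : ℕ} (ho : ordZero s.F = o) :
    (step q S j b s).epsilon ≤
      (PointBlowup.step q j b (⟨s.F, PointBlowup.bigHVec s.exc s.F⟩ : PointBlowup.State σ K)).shade ∧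
    s.epsilon = (⟨s.F, PointBlowup.bigHVec s.exc s.F⟩ : PointBlowup.State σ K).shade := by
  obtain ⟨-, hq, hperm, -⟩ := mohPerm_aux_of_isFirstKind' h1 ho
  have hr : ∀ d ∈ s.F.support, PointBlowup.bigHVec s.exc s.F ≤ d :=
    PointBlowup.bigHVec_le' s.exc s.F
  have hF : s.F ≠ 0 := PointBlowup.ne_zero_of_ordZero_eq' ho
  refine ⟨le_trans (epsilon_step_le_shade_step_aux' q S j b hbj s ho hperm)
    (shade_step_le_shade_pointStep q hj b hbj hbN ⟨s.F, PointBlowup.bigHVec s.exc s.F, s.exc⟩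
      ho hr hq hperm), ?_⟩
  exact PointBlowup.epsilon_eq_shade' s.exc s.toState hF

omit hp [CharP K p] in
/-- **"`δ(y) ∈ ℕ`", first half: an increase of `ε` under the blow-up of a first-kind centre needs
`p ∣ ord₀ F`** (every chart `j ∈ S`, every point of the fibre over `x`).
[cite: CossartPiltant2019, Thm. 3.6 (1) (p. 35)] -/
theorem not_epsilonIncreases_of_isFirstKind_of_not_dvd {S : Finset σ} {j : σ} (hj : j ∈ S)
    (b : σ → K) (hbj : b j = 0) (hbN : ∀ i, i ∉ S → b i = 0) (s : CState σ K)
    (h1 : IsFirstKind p S s) {o : ℕ} (ho : ordZero s.F = o) (hndvd : ¬ p ∣ o) :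
    ¬ EpsilonIncreases p S j b s := by
  intro hinc
  obtain ⟨hpo, -, -, -⟩ := mohPerm_aux_of_isFirstKind' h1 ho
  obtain ⟨hle, hεt⟩ := epsilon_step_le_pointShade' p hj b hbj hbN s h1 ho
  have hr : ∀ d ∈ s.F.support, PointBlowup.bigHVec s.exc s.F ≤ d :=
    PointBlowup.bigHVec_le' s.exc s.F
  have hM := PointBlowup.shade_step_le_of_not_dvd p j b hbj
    (⟨s.F, PointBlowup.bigHVec s.exc s.F⟩ : PointBlowup.State σ K) ho hpo hr hndvd
  unfold EpsilonIncreases at hinc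
  rw [hεt] at hinc
  exact absurd (le_trans hle hM) (not_le.mpr hinc)

/-- **The membership clause: an increase of `ε` under the blow-up of a first-kind centre needs
`p ∣ d_i` for every initial monomial `y^d` of `F` and every `i ≠ j` that is untranslated (`b_i = 0`;
every `i ∉ S` qualifies) or non-exceptional (`i ∉ exc`)** — contrapositive of
"`F_{p,Z} ∈ (k(x')[U₁,…,U_n])^p[{U_j}_{j ∈ J_E ∖ {j₂,…,j_{e'₀}}}]`" (Hauser–Perlega's witness on the
auxiliary state).  [cite: CossartPiltant2019, Thm. 3.6 (1) (p. 35)]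
[cite: HauserPerlega2019PRIMS, §3 Theorem (7)] -/
theorem not_epsilonIncreases_of_isFirstKind_of_not_dvd_apply {S : Finset σ} {j : σ} (hj : j ∈ S)
    (b : σ → K) (hbj : b j = 0) (hbN : ∀ i, i ∉ S → b i = 0) (s : CState σ K)
    (h1 : IsFirstKind p S s) {o : ℕ} (ho : ordZero s.F = o) {i₀ : σ} (hi₀ : i₀ ≠ j)
    (hfix : b i₀ = 0 ∨ i₀ ∉ s.exc) {d₀ : σ →₀ ℕ} (hd₀ : d₀ ∈ s.F.support) (hd₀deg : d₀.degree = o)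
    (hd₀i : ¬ p ∣ d₀ i₀) : ¬ EpsilonIncreases p S j b s := by
  intro hinc
  obtain ⟨hpo, -, -, -⟩ := mohPerm_aux_of_isFirstKind' h1 ho
  obtain ⟨hle, hεt⟩ := epsilon_step_le_pointShade' p hj b hbj hbN s h1 ho
  have hr : ∀ d ∈ s.F.support, PointBlowup.bigHVec s.exc s.F ≤ d :=
    PointBlowup.bigHVec_le' s.exc s.F
  have hfix' : b i₀ = 0 ∨
      (⟨s.F, PointBlowup.bigHVec s.exc s.F⟩ : PointBlowup.State σ K).r i₀ = 0 := by
    rcases hfix with hb | hE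
    · exact Or.inl hb
    · right
      show PointBlowup.bigHVec s.exc s.F i₀ = 0
      rw [PointBlowup.bigHVec_apply', if_neg hE]
  have hM := PointBlowup.shade_step_le_of_not_dvd_apply p j b hbj
    (⟨s.F, PointBlowup.bigHVec s.exc s.F⟩ : PointBlowup.State σ K) ho hpo hr hi₀ hfix' hd₀ hd₀deg
    hd₀i
  unfold EpsilonIncreases at hinc
  rw [hεt] at hinc
  exact absurd (le_trans hle hM) (not_le.mpr hinc)

omit [Fintype σ] [DecidableEq σ] [DecidableEq K] hp [CharP K p] in
/-- A monomial of `F` of degree `ord₀ F` is a monomial of the initial form. [folklore] -/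
private theorem mem_support_initialForm' {F : MvPolynomial σ K} {o : ℕ} (ho : ordZero F = o)
    {d : σ →₀ ℕ} (hd : d ∈ F.support) (hdeg : d.degree = o) : d ∈ (initialForm F).support := by
  rw [MvPolynomial.mem_support_iff]
  unfold HauserPerlega2019.initialForm
  rw [coeff_homogeneousComponent, ho, ENat.toNat_coe, if_pos hdeg]
  exact MvPolynomial.mem_support_iff.mp hd

/-- **"`H_{j'} ∈ pℕ` for every `j' ∈ (J')_E`":** an increase of `ε` under the blow-up of a first-kind
centre needs `p ∣ H_u` for every variable `u ∉ S` transverse to the centre — the boundary components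
`u ∈ exc ∖ S = (J')_E` being the content (for `u ∉ exc`, `H_u = 0` by Prop. 3.1) — by the membership
clause at `u` (`b_u = 0`) combined with Prop. 3.1: `d_u = H_u` on `F_{p,Z}`.
[cite: CossartPiltant2019, Thm. 3.6 (1) (p. 35) with Prop. 3.1 (p. 31)] -/
theorem dvd_bigH_of_epsilonIncreases_of_isFirstKind {S : Finset σ} {j : σ} (hj : j ∈ S)
    (b : σ → K) (hbj : b j = 0) (hbN : ∀ i, i ∉ S → b i = 0) (s : CState σ K)
    (h1 : IsFirstKind p S s) (hinc : EpsilonIncreases p S j b s) {u : σ} (huS : u ∉ S) :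
    ∃ H : ℕ, PointBlowup.bigH s.F u = (H : ℕ∞) ∧ p ∣ H := by
  have hF : s.F ≠ 0 := F_ne_zero_of_epsilonIncreases' hinc
  obtain ⟨o, ho⟩ := PointBlowup.exists_ordZero_eq' hF
  obtain ⟨⟨d₀, hd₀, hd₀deg⟩, -⟩ := (ordZero_eq_nat_iff s.F o).mp ho
  have hd₀s : d₀ ∈ s.F.support := MvPolynomial.mem_support_iff.mpr hd₀
  have huj : u ≠ j := fun h => huS (h ▸ hj)
  have hdvd : p ∣ d₀ u := by
    by_contra hnd
    exact not_epsilonIncreases_of_isFirstKind_of_not_dvd_apply p hj b hbj hbN s h1 ho huj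
      (Or.inl (hbN u huS)) hd₀s hd₀deg hnd hinc
  refine ⟨d₀ u, ?_, hdvd⟩
  exact (initialForm_exponent_eq_bigH_of_isFirstKind h1 d₀
    (mem_support_initialForm' ho hd₀s hd₀deg) u huS).symm

/-- **"`δ(y) ∈ ℕ`": an increase of `ε` under the blow-up of a first-kind centre needs
`p ∣ ord_{C_S} F = p δ(y)`** (from `p ∣ ord₀ F = ord_{C_S} F + Σ_{exc∖S} H_u` and `p ∣ H_u`).
[cite: CossartPiltant2019, Thm. 3.6 (1) (p. 35) with Prop. 3.1 (p. 31)] -/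
theorem dvd_ordAlong_of_epsilonIncreases_of_isFirstKind {S : Finset σ} {j : σ} (hj : j ∈ S)
    (b : σ → K) (hbj : b j = 0) (hbN : ∀ i, i ∉ S → b i = 0) (s : CState σ K)
    (h1 : IsFirstKind p S s) (hinc : EpsilonIncreases p S j b s) :
    ∃ a : ℕ, ordAlong S s.F = (a : ℕ∞) ∧ p ∣ a := by
  have hF : s.F ≠ 0 := F_ne_zero_of_epsilonIncreases' hinc
  obtain ⟨o, ho⟩ := PointBlowup.exists_ordZero_eq' hF
  have hpo : p ∣ o := by
    by_contra hnd
    exact not_epsilonIncreases_of_isFirstKind_of_not_dvd p hj b hbj hbN s h1 ho hnd hinc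
  -- finite `H` and the decomposition `ord₀ F = ord_{C_S} F + Σ_{exc∖S} H_u`
  have hH : ∀ u ∈ s.exc \ S, ∃ H : ℕ, PointBlowup.bigH s.F u = (H : ℕ∞) ∧ p ∣ H := fun u hu =>
    dvd_bigH_of_epsilonIncreases_of_isFirstKind p hj b hbj hbN s h1 hinc
      (Finset.mem_sdiff.mp hu).2
  choose! H hH1 hH2 using hH
  have hsum : ∑ u ∈ s.exc \ S, PointBlowup.bigH s.F u = ((∑ u ∈ s.exc \ S, H u : ℕ) : ℕ∞) := by
    rw [Nat.cast_sum]
    exact Finset.sum_congr rfl fun u hu => hH1 u hu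
  have hdec := ordZero_eq_of_isFirstKind h1 hF
  rw [ho, hsum] at hdec
  -- `ordAlong` is finite
  have hne : ordAlong S s.F ≠ ⊤ := by
    intro htop
    rw [htop, top_add] at hdec
    exact ENat.coe_ne_top _ hdec
  obtain ⟨a, ha⟩ : ∃ a : ℕ, ordAlong S s.F = (a : ℕ∞) := ⟨_, (ENat.coe_toNat hne).symm⟩
  refine ⟨a, ha, ?_⟩
  rw [ha, ← Nat.cast_add] at hdec
  have hdec' : o = a + ∑ u ∈ s.exc \ S, H u := by exact_mod_cast hdec
  have hdvs : p ∣ ∑ u ∈ s.exc \ S, H u := Finset.dvd_sum fun u hu => hH2 u hu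
  have := (Nat.dvd_add_right hdvs).mp (by rw [add_comm, ← hdec']; exact hpo)
  exact this

/-- **`V(F_{p,Z},E,m_S) ≠ 0` forbids an increase of `ε` under the blow-up of a centre of the first
kind**, at every point of the fibre over `x` in every chart `j ∈ S` ([CP19, Thm. 3.6 (1)]:
"`ε(y) = ε(x) = ω(x)`", contrapositive; Def. 2.16, Prop. 2.16 (i)).
[cite: CossartPiltant2019, Thm. 3.6 (1) (p. 35)] -/
theorem not_epsilonIncreases_of_isFirstKind_of_vNonzero {S : Finset σ} {j : σ} (hj : j ∈ S)
    (b : σ → K) (hbj : b j = 0) (hbN : ∀ i, i ∉ S → b i = 0) (s : CState σ K)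
    (h1 : IsFirstKind p S s) (hV : PointBlowup.VNonzero s.exc s.F) :
    ¬ EpsilonIncreases p S j b s := by
  intro hinc
  have hF : s.F ≠ 0 := F_ne_zero_of_epsilonIncreases' hinc
  obtain ⟨o, ho⟩ := PointBlowup.exists_ordZero_eq' hF
  obtain ⟨hpo, -, -, -⟩ := mohPerm_aux_of_isFirstKind' h1 ho
  obtain ⟨t, htE, hpd⟩ := hV
  by_cases htj : t = j
  · subst htj
    obtain ⟨hle, hεt⟩ := epsilon_step_le_pointShade' p hj b hbj hbN s h1 ho
    have hM := PointBlowup.shade_step_aux_le_epsilon_of_pderiv_chart_ne_zero p t b hbj s.toState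
      s.exc htE ho hpo hpd
    unfold EpsilonIncreases at hinc
    exact absurd (le_trans hle hM) (not_le.mpr hinc)
  · obtain ⟨d₀, hd₀, hd₀deg, hd₀t⟩ :=
      PointBlowup.exists_not_dvd_of_pderiv_initialForm_ne_zero p ho hpd
    exact not_epsilonIncreases_of_isFirstKind_of_not_dvd_apply p hj b hbj hbN s h1 ho htj
      (Or.inr htE) hd₀ hd₀deg hd₀t hinc

/-- **An increase of `ε` under the blow-up of a first-kind centre forces `ω(x) = ε(x)`.**
[cite: CossartPiltant2019, Thm. 3.6 (1) (p. 35)] -/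
theorem omega_eq_epsilon_of_epsilonIncreases_of_isFirstKind {S : Finset σ} {j : σ} (hj : j ∈ S)
    (b : σ → K) (hbj : b j = 0) (hbN : ∀ i, i ∉ S → b i = 0) (s : CState σ K)
    (h1 : IsFirstKind p S s) (hinc : EpsilonIncreases p S j b s) : s.omega = s.epsilon := by
  by_cases hV : PointBlowup.VNonzero s.exc s.F
  · exact absurd hinc (not_epsilonIncreases_of_isFirstKind_of_vNonzero p hj b hbj hbN s h1 hV)
  · exact omega_eq_of_not_vNonzero s hV

/-- **[CP19, Thm. 3.6 (1)] read at one blow-up of a centre OF THE FIRST KIND, in the model: the atlas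
predicate `EpsilonIncreaseForcesFirstKindAt p S j b s` holds** — for every set of centre variables
`S`, every chart, every point and every state at which `C_S` is permissible of the first kind (the
hypotheses `IsEquimultiplePoint`, `0 < ω(x) < ⊤` of the predicate are not used).  Centres of the
second kind are not covered by this theorem.  [cite: CossartPiltant2019, Thm. 3.6 (1) (p. 35)] -/
theorem epsilonIncreaseForcesFirstKindAt_of_isFirstKind (S : Finset σ) (j : σ) (b : σ → K)
    (s : CState σ K) (h1 : IsFirstKind p S s) : EpsilonIncreaseForcesFirstKindAt p S j b s :=
  fun hj hbj hbN _ _ _ _ hinc =>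
    ⟨h1.2, omega_eq_epsilon_of_epsilonIncreases_of_isFirstKind p hj b hbj hbN s h1 hinc⟩

end FirstKind

end CState

end CentreBlowup

end Literature.AlgebraicGeometry.Resolution
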